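import Mathlib
import Literature.MathematicalPhysics.MHD.SolovevCheaseFamily
import HarnessLib

/-!
# Freidberg's safety factor (6.35) on the printed flux-surface loop of the CHEASE / Lee–Cerfon Solov'ev
# equilibrium equals the printed radial integral and closed form (q4) — every surface (proved)

Lee–Cerfon, Comput. Phys. Commun. 190 (2015) 72–88 (arXiv:1409.3523) §4.1 «Example 1: Solov'ev profiles» —
bib `LeeCerfon2015`; locator read on the page (LADDER-GRIDFUSION seat gridfusion-model-5, 2026-08-26; corpus
arXiv:1409.3523 chunk p0013) — prints, for the Solov'ev solution (solo2) (`Solovev.psiLC`), the surface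
parametrisation `R² = R₀² + 2aR₀ cos t`, `Z = κ a (R₀/R) sin t` and the exact safety factor
`q(Ψ_s) = (F_B/π)∫ dR/(R|∂_ZΨ|) = (2q₀R₀³/π)∫_{R_min}^{R_max} dR/(R²((R²−R_min²)(R_max²−R²))^{1/2})
 = (2q₀/π)(R₀³/(R_min²R_max)) E(k)` (their (q4); typed in `SolovevCheaseFamily.lean` as `qLCIntegral`,
`qLC`, with the elliptic evaluation `QLCClosedForm` discharged there).

THIS FILE closes the remaining link to the tree's DEFINITION of the safety factor — Freidberg, *Ideal MHD*
(2014) eq. (6.35) `q(ψ) = (F/2π)∮ dl/(R²B_p)` with EUCLIDEAN arc length, `GradShafranov.safetyFactorE`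
(the RULING-15 repair) — on EVERY flux surface of the family, not only the plasma edge:

* `lcLoop R₀ κ r` — the printed parametrisation as a closed curve `t ↦ (R(t), Z(t))`, `t ∈ [0, 2π]`, of the
  surface with effective minor radius `r` (`0 < r < R₀/2`); `psiLC_lcLoop`: `Ψ` is constant on it;
* `lcLoop_integrand` — the pointwise identity `|γ′(t)|/(R²B_p) = (R₀³q₀/F_B)·u(t)^{-3/2}`,
  `u = R² = R₀² + 2rR₀ cos t` (along the loop `(R′, Z′) = (κ/(2cR²))(−Ψ_Z, Ψ_R)`, `c = κF_B/(2R₀³q₀)`,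
  and `∇Ψ ≠ 0`);
* `safetyFactorE_lcLoop` — `safetyFactorE F_B Ψ (lcLoop R₀ κ r) (2π) = (q₀R₀³/π)∫₀^π u(t)^{-3/2} dt`;
* `integral_lcU_eq_radial` — the monotone substitution `R = (R₀² − 2rR₀ cos x)^{1/2}` back to the printed
  radial form (Mathlib `intervalIntegral.integral_comp_mul_deriv_of_deriv_nonneg`, no integrability
  hypothesis, so the endpoint singularities of the radial integrand need no separate treatment);
* **`safetyFactorE_lcLoop_eq_qLCIntegral`, `safetyFactorE_lcLoop_eq_qLC`** — Freidberg's (6.35) on the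
  printed loop `=` the printed radial integral `=` the printed closed form with `E(k)`,
  `R_min = (R₀² − 2rR₀)^{1/2}`, `R_max = (R₀² + 2rR₀)^{1/2}`.

Relation to the cell's other files (no duplication): sos-6's `Bench/SolovevPCF{Iter,Nstx}QedgeLoop.lean`
prove the EDGE instance (`r = a`) for the two PCF shapes on a four-arc algebraic loop; lit-4's
`QLCSurface` section of `SolovevCheaseFamily.lean` records the graph-form integrand `(F_B/π)dR/(R|∂_ZΨ|)`;
here the statement is generic in `(κ, F_B, R₀, q₀, a, r)` and uses the smooth printed loop, so it gives the
whole `q`-PROFILE of the family (hence of every PCF instance, `psiPCF_eq_LCform`) as Freidberg's functional.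
That the loop traces `{Ψ = Ψ_s} ∩ {R > 0}` exactly once (`GradShafranov.IsFluxSurfaceLoop`) is proved in
the companion file `SolovevFluxSurfaceLoopTrace.lean`.
HONEST FRAMING (three columns): exact real analysis about MODEL objects (ideal MHD, Solov'ev profiles,
analytic fixed boundary); a certified enclosure of `E(k)` on a named surface is a Bench matter; nothing here
says anything is stable. Typer/prover: gridfusion-model-5 (g2).
-/

noncomputable section

namespace Literature.MathematicalPhysics.MHD.Solovev

open GradShafranov _root_.Real MeasureTheory intervalIntegral Set

/-! ## The printed surface parametrisation `R² = R₀² + 2 r R₀ cos t`, `Z = κ r (R₀/R) sin t` -/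

/-- `u(t) = R₀² + 2 r R₀ cos t`: the squared major radius `R²` along the printed parametrisation of the
flux surface of effective minor radius `r` of the Lee–Cerfon/CHEASE Solov'ev equilibrium.
[cite: LeeCerfon2015, §4.1 (boundary parametrisation)] -/
def lcU (R₀ r t : ℝ) : ℝ := R₀ ^ 2 + 2 * r * R₀ * Real.cos t

/-- The flux-surface parametrisation AS PRINTED in Lee–Cerfon §4.1 (there for the plasma boundary,
`r = a`): `R² = R₀² + 2 r R₀ cos t`, `Z = κ r (R₀/R) sin t`, `t ∈ [0, 2π]`, as a curve
`t ↦ (R(t), Z(t))`. [cite: LeeCerfon2015, §4.1 (boundary parametrisation)] -/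
def lcLoop (R₀ κ r : ℝ) (t : ℝ) : ℝ × ℝ :=
  (Real.sqrt (lcU R₀ r t), κ * r * R₀ * Real.sin t / Real.sqrt (lcU R₀ r t))

/-- The printed `R²(t) = R₀² + 2rR₀ cos t` is positive: `u(t) ≥ R₀(R₀ - 2r) > 0` when `0 ≤ r`,
`2r < R₀` (so `R(t) = u(t)^{1/2}` is a genuine major radius). [cite: LeeCerfon2015, §4.1 (boundary parametrisation)] -/
theorem lcU_pos {R₀ r : ℝ} (hR₀ : 0 < R₀) (hr : 0 ≤ r) (h2r : 2 * r < R₀) (t : ℝ) :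
    0 < lcU R₀ r t := by
  unfold lcU
  have hc := Real.neg_one_le_cos t
  have h1 : 0 ≤ 2 * r * R₀ * (Real.cos t + 1) :=
    mul_nonneg (by positivity) (by linarith)
  have h2 : 0 < R₀ * (R₀ - 2 * r) := mul_pos hR₀ (by linarith)
  nlinarith

/-- Derivative of the printed `R²(t)`: `u'(t) = -2 r R₀ sin t`. [cite: LeeCerfon2015, §4.1 (boundary parametrisation)] -/
theorem hasDerivAt_lcU (R₀ r t : ℝ) :
    HasDerivAt (lcU R₀ r) (-(2 * r * R₀ * Real.sin t)) t := by
  have h := ((Real.hasDerivAt_cos t).const_mul (2 * r * R₀)).const_add (R₀ ^ 2)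
  have e : (fun x => R₀ ^ 2 + 2 * r * R₀ * Real.cos x) = lcU R₀ r := by
    funext x; rfl
  rw [e] at h
  exact h.congr_deriv (by ring)

/-- Derivative of the printed `R(t) = (R₀² + 2rR₀ cos t)^{1/2}`: `R'(t) = -2 r R₀ sin t / (2 R(t))`.
[cite: LeeCerfon2015, §4.1 (boundary parametrisation)] -/
theorem hasDerivAt_lcLoop_fst {R₀ r : ℝ} (hR₀ : 0 < R₀) (hr : 0 ≤ r) (h2r : 2 * r < R₀) (κ t : ℝ) :
    HasDerivAt (fun s => (lcLoop R₀ κ r s).1)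
      (-(2 * r * R₀ * Real.sin t) / (2 * Real.sqrt (lcU R₀ r t))) t := by
  show HasDerivAt (fun s => Real.sqrt (lcU R₀ r s)) _ t
  exact (hasDerivAt_lcU R₀ r t).sqrt (lcU_pos hR₀ hr h2r t).ne'

/-- Derivative of the printed `Z(t) = κ r R₀ sin t / R(t)` (quotient rule).
[cite: LeeCerfon2015, §4.1 (boundary parametrisation)] -/
theorem hasDerivAt_lcLoop_snd {R₀ r : ℝ} (hR₀ : 0 < R₀) (hr : 0 ≤ r) (h2r : 2 * r < R₀) (κ t : ℝ) :
    HasDerivAt (fun s => (lcLoop R₀ κ r s).2)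
      ((κ * r * R₀ * Real.cos t * Real.sqrt (lcU R₀ r t)
        - κ * r * R₀ * Real.sin t * (-(2 * r * R₀ * Real.sin t) / (2 * Real.sqrt (lcU R₀ r t))))
        / Real.sqrt (lcU R₀ r t) ^ 2) t := by
  show HasDerivAt (fun s => κ * r * R₀ * Real.sin s / Real.sqrt (lcU R₀ r s)) _ t
  have h1 : HasDerivAt (fun s => κ * r * R₀ * Real.sin s) (κ * r * R₀ * Real.cos t) t :=
    (Real.hasDerivAt_sin t).const_mul _
  have h2 := (hasDerivAt_lcU R₀ r t).sqrt (lcU_pos hR₀ hr h2r t).ne'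
  exact h1.div h2 (Real.sqrt_pos.2 (lcU_pos hR₀ hr h2r t)).ne'

/-! ## Derivatives of the Lee–Cerfon flux function -/

/-- Derivative of the even quartic `A + B x² + C x⁴`. [folklore] -/
private theorem fs_hasDerivAt_evenQuartic (A B C x : ℝ) :
    HasDerivAt (fun x => A + B * x ^ 2 + C * x ^ 4) (2 * B * x + 4 * C * x ^ 3) x := by
  have h := ((hasDerivAt_const x A).fun_add ((hasDerivAt_pow 2 x).const_mul B)).fun_add
    ((hasDerivAt_pow 4 x).const_mul C)
  exact h.congr_deriv (by norm_num; ring)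

/-- `∂Ψ/∂R` of (solo2): `c[(R² - R₀²)R + 2RZ²/κ²]`, `c = κF_B/(2R₀³q₀)`. [cite: LeeCerfon2015, §4.1 eq. (solo2)] -/
theorem dR_psiLC (κ FB R₀ q₀ a R Z : ℝ) :
    dR (psiLC κ FB R₀ q₀ a) R Z
      = κ * FB / (2 * R₀ ^ 3 * q₀) * ((R ^ 2 - R₀ ^ 2) * R + 2 * R * Z ^ 2 / κ ^ 2) := by
  unfold dR
  set c := κ * FB / (2 * R₀ ^ 3 * q₀) with hc
  have e : (fun r => psiLC κ FB R₀ q₀ a r Z)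
      = fun r => c * (1 / 4 * R₀ ^ 4 - a ^ 2 * R₀ ^ 2) + c * (Z ^ 2 / κ ^ 2 - R₀ ^ 2 / 2) * r ^ 2
          + c / 4 * r ^ 4 := by
    funext r; unfold psiLC; rw [← hc]; ring
  rw [e, (fs_hasDerivAt_evenQuartic _ _ _ R).deriv]
  ring

/-- The flux function is CONSTANT along the printed loop: `Ψ(R(t), Z(t)) = c R₀² (r² - a²)`. [cite: LeeCerfon2015, §4.1] -/
theorem psiLC_lcLoop {R₀ r κ : ℝ} (hR₀ : 0 < R₀) (hr : 0 ≤ r) (h2r : 2 * r < R₀) (hκ : κ ≠ 0)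
    (FB q₀ a t : ℝ) :
    psiLC κ FB R₀ q₀ a (lcLoop R₀ κ r t).1 (lcLoop R₀ κ r t).2
      = κ * FB / (2 * R₀ ^ 3 * q₀) * (R₀ ^ 2 * (r ^ 2 - a ^ 2)) := by
  have hu := lcU_pos hR₀ hr h2r t
  set s := Real.sqrt (lcU R₀ r t) with hs_def
  have hs : 0 < s := Real.sqrt_pos.2 hu
  have hs2 : s ^ 2 = R₀ ^ 2 + 2 * r * R₀ * Real.cos t := by
    rw [hs_def, Real.sq_sqrt hu.le]; rfl
  have hsc := Real.sin_sq_add_cos_sq t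
  simp only [lcLoop]
  rw [← hs_def]
  unfold psiLC
  have e1 : s ^ 2 * (κ * r * R₀ * Real.sin t / s) ^ 2 / κ ^ 2 = r ^ 2 * R₀ ^ 2 * Real.sin t ^ 2 := by
    field_simp
  rw [e1, hs2]
  linear_combination (κ * FB / (2 * R₀ ^ 3 * q₀)) * (r ^ 2 * R₀ ^ 2) * hsc


/-! ## Freidberg's safety-factor integrand (6.35) along the printed loop -/

/-- Algebra of the integrand: if `(R', Z') = λ(-Ψ_Z, Ψ_R)` with `λ > 0`, `R = s > 0`, `∇Ψ ≠ 0`, then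
`(1/(R² B_p))·|γ'| = λ/R` where `B_p = |∇Ψ|/R`. [folklore] -/
private theorem fs_integrand_aux {s lam P Q R' Z' : ℝ} (hs : 0 < s) (hl : 0 < lam)
    (hN : 0 < Q ^ 2 + P ^ 2) (hR : R' = -(lam * Q)) (hZ : Z' = lam * P) :
    1 / (s ^ 2 * Real.sqrt ((-(s⁻¹ * Q)) ^ 2 + (s⁻¹ * P) ^ 2)) * Real.sqrt (R' ^ 2 + Z' ^ 2)
      = lam / s := by
  have h1 : (-(s⁻¹ * Q)) ^ 2 + (s⁻¹ * P) ^ 2 = (s⁻¹) ^ 2 * (Q ^ 2 + P ^ 2) := by ring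
  have h2 : R' ^ 2 + Z' ^ 2 = lam ^ 2 * (Q ^ 2 + P ^ 2) := by rw [hR, hZ]; ring
  rw [h1, h2, Real.sqrt_mul (sq_nonneg _), Real.sqrt_mul (sq_nonneg _),
    Real.sqrt_sq (inv_nonneg.2 hs.le), Real.sqrt_sq hl.le]
  have hN' : Real.sqrt (Q ^ 2 + P ^ 2) ≠ 0 := (Real.sqrt_pos.2 hN).ne'
  field_simp

/-- **The integrand of Freidberg's `q` (6.35) along the printed loop is elementary:** with Euclidean arc
length, `|γ'(t)| / (R² B_p) = (R₀³ q₀ / F_B) · u(t)^{-3/2}`, `u = R² = R₀² + 2 r R₀ cos t`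
(`B_p = |∇Ψ|/R`; along the loop `(R', Z') = (κ/(2cR²))·(-Ψ_Z, Ψ_R)`). [cite: LeeCerfon2015, §4.1 eq. (q4)] -/
theorem lcLoop_integrand {R₀ κ FB q₀ r : ℝ} (hR₀ : 0 < R₀) (hκ : 0 < κ) (hFB : 0 < FB) (hq₀ : 0 < q₀)
    (hr : 0 < r) (h2r : 2 * r < R₀) (a t : ℝ) :
    1 / ((lcLoop R₀ κ r t).1 ^ 2 * fieldBpol (psiLC κ FB R₀ q₀ a) (lcLoop R₀ κ r t).1 (lcLoop R₀ κ r t).2)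
        * speed (lcLoop R₀ κ r) t
      = R₀ ^ 3 * q₀ / FB * (lcU R₀ r t * Real.sqrt (lcU R₀ r t))⁻¹ := by
  have hu := lcU_pos hR₀ hr.le h2r t
  have hsc := Real.sin_sq_add_cos_sq t
  have hd1 := (hasDerivAt_lcLoop_fst hR₀ hr.le h2r κ t).deriv
  have hd2 := (hasDerivAt_lcLoop_snd hR₀ hr.le h2r κ t).deriv
  unfold speed
  rw [hd1, hd2]
  simp only [lcLoop, fieldBpol, fieldBR, fieldBZ, dR_psiLC, dZ_psiLC]
  set u := lcU R₀ r t with hu_def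
  set s := Real.sqrt u with hs_def
  set c := κ * FB / (2 * R₀ ^ 3 * q₀) with hc_def
  have hs : 0 < s := Real.sqrt_pos.2 hu
  have hsu : s ^ 2 = u := by rw [hs_def, Real.sq_sqrt hu.le]
  have hs2 : s ^ 2 = R₀ ^ 2 + 2 * r * R₀ * Real.cos t := by rw [hsu, hu_def]; rfl
  have hc : 0 < c := by rw [hc_def]; positivity
  have e : s ^ 2 - R₀ ^ 2 = 2 * r * R₀ * Real.cos t := by rw [hs2]; ring
  set Q := c * (2 * s ^ 2 / κ ^ 2) * (κ * r * R₀ * Real.sin t / s) with hQ_def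
  set P := c * ((s ^ 2 - R₀ ^ 2) * s + 2 * s * (κ * r * R₀ * Real.sin t / s) ^ 2 / κ ^ 2) with hP_def
  have hQ' : Q = 2 * c * r * R₀ * s * Real.sin t / κ := by
    rw [hQ_def]; field_simp
  have hP' : P = 2 * c * r * R₀ * (s ^ 2 * Real.cos t + r * R₀ * Real.sin t ^ 2) / s := by
    rw [hP_def, e]; field_simp
  have hN : 0 < Q ^ 2 + P ^ 2 := by
    by_cases hsin : Real.sin t = 0
    · have hcos : Real.cos t ≠ 0 := by
        intro h0; rw [hsin, h0] at hsc; norm_num at hsc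
      have hP0 : P ≠ 0 := by
        rw [hP', hsin]
        have : 2 * c * r * R₀ * (s ^ 2 * Real.cos t + r * R₀ * (0 : ℝ) ^ 2) / s
            = 2 * c * r * R₀ * s * Real.cos t := by rw [div_eq_iff hs.ne']; ring
        rw [this]
        exact mul_ne_zero (by positivity) hcos
      positivity
    · have hQ0 : Q ≠ 0 := by
        rw [hQ']
        exact div_ne_zero (mul_ne_zero (by positivity) hsin) hκ.ne'
      positivity
  have key := fs_integrand_aux (s := s) (lam := κ / (2 * c * s ^ 2)) (P := P) (Q := Q)
    (R' := -(2 * r * R₀ * Real.sin t) / (2 * s))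
    (Z' := (κ * r * R₀ * Real.cos t * s
      - κ * r * R₀ * Real.sin t * (-(2 * r * R₀ * Real.sin t) / (2 * s))) / s ^ 2)
    hs (by positivity) hN (by rw [hQ_def]; field_simp) (by rw [hP_def, e]; field_simp; ring)
  rw [key, hc_def, ← hsu]
  field_simp

/-- Continuity of `t ↦ (u(t)√u(t))⁻¹`. [folklore] -/
private theorem continuous_lcU_inv32 {R₀ r : ℝ} (hR₀ : 0 < R₀) (hr : 0 ≤ r) (h2r : 2 * r < R₀) :
    Continuous fun t => (lcU R₀ r t * Real.sqrt (lcU R₀ r t))⁻¹ := by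
  have hc : Continuous (lcU R₀ r) := by unfold lcU; fun_prop
  exact (hc.mul hc.sqrt).inv₀ fun t =>
    (mul_pos (lcU_pos hR₀ hr h2r t) (Real.sqrt_pos.2 (lcU_pos hR₀ hr h2r t))).ne'

/-- `∫₀^{2π} (u√u)⁻¹ dt = 2 ∫₀^{π} (u√u)⁻¹ dt` (reflection `t ↦ 2π - t`). [folklore] -/
private theorem integral_lcU_two_pi {R₀ r : ℝ} (hR₀ : 0 < R₀) (hr : 0 ≤ r) (h2r : 2 * r < R₀) :
    ∫ t in (0 : ℝ)..(2 * π), (lcU R₀ r t * Real.sqrt (lcU R₀ r t))⁻¹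
      = 2 * ∫ t in (0 : ℝ)..π, (lcU R₀ r t * Real.sqrt (lcU R₀ r t))⁻¹ := by
  have hG := continuous_lcU_inv32 hR₀ hr h2r
  have h1 : (∫ t in (0 : ℝ)..π, (lcU R₀ r t * Real.sqrt (lcU R₀ r t))⁻¹)
      + (∫ t in π..(2 * π), (lcU R₀ r t * Real.sqrt (lcU R₀ r t))⁻¹)
      = ∫ t in (0 : ℝ)..(2 * π), (lcU R₀ r t * Real.sqrt (lcU R₀ r t))⁻¹ :=
    intervalIntegral.integral_add_adjacent_intervals (hG.intervalIntegrable _ _)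
      (hG.intervalIntegrable _ _)
  have h2 : ∫ t in π..(2 * π), (lcU R₀ r t * Real.sqrt (lcU R₀ r t))⁻¹
      = ∫ t in (0 : ℝ)..π, (lcU R₀ r t * Real.sqrt (lcU R₀ r t))⁻¹ := by
    have h := intervalIntegral.integral_comp_sub_left
      (f := fun t => (lcU R₀ r t * Real.sqrt (lcU R₀ r t))⁻¹) (a := 0) (b := π) (2 * π)
    rw [show 2 * π - π = π by ring, sub_zero] at h
    rw [← h]
    apply intervalIntegral.integral_congr
    intro x _
    simp only [lcU, Real.cos_two_pi_sub]
  rw [← h1, h2]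
  ring

/-- **Freidberg's safety factor (6.35), Euclidean arc length, of the Lee–Cerfon Solov'ev equilibrium on the
printed surface loop is the one-dimensional integral `q = (q₀R₀³/π) ∫₀^π u(t)^{-3/2} dt`**,
`u(t) = R₀² + 2 r R₀ cos t` (`0 < r < R₀/2`; `F_B, κ, q₀, R₀ > 0`). [cite: LeeCerfon2015, §4.1 eq. (q4)] -/
theorem safetyFactorE_lcLoop {R₀ κ FB q₀ r : ℝ} (hR₀ : 0 < R₀) (hκ : 0 < κ) (hFB : 0 < FB)
    (hq₀ : 0 < q₀) (hr : 0 < r) (h2r : 2 * r < R₀) (a : ℝ) :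
    safetyFactorE FB (psiLC κ FB R₀ q₀ a) (lcLoop R₀ κ r) (2 * π)
      = q₀ * R₀ ^ 3 / π * ∫ t in (0 : ℝ)..π, (lcU R₀ r t * Real.sqrt (lcU R₀ r t))⁻¹ := by
  unfold safetyFactorE loopIntegralE
  have h : ∫ t in (0 : ℝ)..(2 * π),
      1 / ((lcLoop R₀ κ r t).1 ^ 2 * fieldBpol (psiLC κ FB R₀ q₀ a) (lcLoop R₀ κ r t).1
        (lcLoop R₀ κ r t).2) * speed (lcLoop R₀ κ r) t
      = ∫ t in (0 : ℝ)..(2 * π), R₀ ^ 3 * q₀ / FB * (lcU R₀ r t * Real.sqrt (lcU R₀ r t))⁻¹ :=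
    intervalIntegral.integral_congr fun t _ => lcLoop_integrand hR₀ hκ hFB hq₀ hr h2r a t
  rw [h, intervalIntegral.integral_const_mul, integral_lcU_two_pi hR₀ hr.le h2r]
  field_simp


/-! ## Back to the printed radial form (q4): `t ↦ R = (R₀² + 2 r R₀ cos t)^{1/2}` -/

/-- Interval integrals of two functions agreeing on the OPEN interval coincide. [folklore] -/
private theorem fs_integral_congr_Ioo {f g : ℝ → ℝ} {a b : ℝ} (hab : a ≤ b)
    (h : ∀ x ∈ Ioo a b, f x = g x) : ∫ x in a..b, f x = ∫ x in a..b, g x := by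
  rw [intervalIntegral.integral_of_le hab, intervalIntegral.integral_of_le hab,
    integral_Ioc_eq_integral_Ioo, integral_Ioc_eq_integral_Ioo]
  exact setIntegral_congr_fun measurableSet_Ioo h

/-- **The `t`-integral is twice the printed radial integral of (q4):** for `0 < r < R₀/2`, with
`R_min = (R₀² − 2rR₀)^{1/2}`, `R_max = (R₀² + 2rR₀)^{1/2}` the midplane radii of the surface,
`∫₀^π dt/u(t)^{3/2} = 2 ∫_{R_min}^{R_max} dR/(R²((R² − R_min²)(R_max² − R²))^{1/2})`
(substitution `R² = R₀² − 2rR₀ cos x`, `x = π − t`, monotone on `[0, π]`). [cite: LeeCerfon2015, §4.1 eq. (q4)] -/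
theorem integral_lcU_eq_radial {R₀ r : ℝ} (hR₀ : 0 < R₀) (hr : 0 < r) (h2r : 2 * r < R₀) :
    ∫ t in (0 : ℝ)..π, (lcU R₀ r t * Real.sqrt (lcU R₀ r t))⁻¹
      = 2 * ∫ R in Real.sqrt (R₀ ^ 2 - 2 * r * R₀)..Real.sqrt (R₀ ^ 2 + 2 * r * R₀),
          1 / (R ^ 2 * Real.sqrt ((R ^ 2 - (R₀ ^ 2 - 2 * r * R₀)) * ((R₀ ^ 2 + 2 * r * R₀) - R ^ 2))) := by
  have hπ : (0 : ℝ) ≤ π := Real.pi_pos.le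
  set m : ℝ := R₀ ^ 2 with hm
  set d : ℝ := 2 * r * R₀ with hd
  have hd0 : 0 < d := by rw [hd]; positivity
  have hdm : d < m := by rw [hd, hm]; nlinarith
  -- the reflected integrand `ũ(x) = m - d cos x = u(π - x)`
  have hv : ∀ x, 0 < m - d * Real.cos x := fun x => by nlinarith [Real.cos_le_one x]
  -- step A: reflect `t = π - x`
  have hA : ∫ t in (0 : ℝ)..π, (lcU R₀ r t * Real.sqrt (lcU R₀ r t))⁻¹
      = ∫ x in (0 : ℝ)..π, ((m - d * Real.cos x) * Real.sqrt (m - d * Real.cos x))⁻¹ := by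
    have h := intervalIntegral.integral_comp_sub_left
      (f := fun t => (lcU R₀ r t * Real.sqrt (lcU R₀ r t))⁻¹) (a := 0) (b := π) π
    rw [sub_self, sub_zero] at h
    rw [← h]
    apply intervalIntegral.integral_congr
    intro x _
    simp only [lcU, Real.cos_pi_sub, hm, hd]
    ring_nf
  -- step B: the substitution `R = f x = (m - d cos x)^{1/2}`
  set f : ℝ → ℝ := fun x => Real.sqrt (m - d * Real.cos x) with hf_def
  set f' : ℝ → ℝ := fun x => d * Real.sin x / (2 * Real.sqrt (m - d * Real.cos x)) with hf'_def
  set g : ℝ → ℝ := fun R => 1 / (R ^ 2 * Real.sqrt ((R ^ 2 - (m - d)) * ((m + d) - R ^ 2)))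
    with hg_def
  have hderiv : ∀ x, HasDerivAt f (f' x) x := by
    intro x
    have h1 : HasDerivAt (fun x => m - d * Real.cos x) (d * Real.sin x) x := by
      have := ((Real.hasDerivAt_cos x).const_mul d).const_sub m
      exact this.congr_deriv (by ring)
    have h2 := h1.sqrt (hv x).ne'
    rw [hf_def, hf'_def]
    exact h2
  have hcont : ContinuousOn f (Set.uIcc (0 : ℝ) π) := fun x _ => (hderiv x).continuousAt.continuousWithinAt
  have hnonneg : ∀ x ∈ Ioo (min (0 : ℝ) π) (max (0 : ℝ) π), 0 ≤ f' x := by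
    intro x hx
    rw [min_eq_left hπ, max_eq_right hπ] at hx
    have hs : 0 ≤ Real.sin x := Real.sin_nonneg_of_nonneg_of_le_pi hx.1.le hx.2.le
    rw [hf'_def]
    positivity
  have hsub := intervalIntegral.integral_comp_mul_deriv_of_deriv_nonneg (g := g) hcont
    (fun x _ => hderiv x) hnonneg
  have hf0 : f 0 = Real.sqrt (R₀ ^ 2 - 2 * r * R₀) := by
    simp only [hf_def, Real.cos_zero, mul_one, hm, hd]
  have hfπ : f π = Real.sqrt (R₀ ^ 2 + 2 * r * R₀) := by
    simp only [hf_def, Real.cos_pi, mul_neg, mul_one, sub_neg_eq_add, hm, hd]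
  -- step C: the pulled-back integrand is `(1/2)(ũ√ũ)⁻¹` on the open interval
  have hC : ∫ x in (0 : ℝ)..π, ((m - d * Real.cos x) * Real.sqrt (m - d * Real.cos x))⁻¹
      = ∫ x in (0 : ℝ)..π, 2 * ((g ∘ f) x * f' x) := by
    refine fs_integral_congr_Ioo hπ fun x hx => ?_
    have hsin : 0 < Real.sin x := Real.sin_pos_of_pos_of_lt_pi hx.1 hx.2
    have hvx := hv x
    set v := m - d * Real.cos x with hv_def
    have hsq : Real.sqrt v ^ 2 = v := Real.sq_sqrt hvx.le
    have hsqpos : 0 < Real.sqrt v := Real.sqrt_pos.2 hvx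
    have hprod : (Real.sqrt v ^ 2 - (m - d)) * ((m + d) - Real.sqrt v ^ 2) = (d * Real.sin x) ^ 2 := by
      rw [hsq, hv_def]
      linear_combination (-(d ^ 2)) * Real.sin_sq_add_cos_sq x
    simp only [Function.comp, hg_def, hf_def, hf'_def]
    rw [← hv_def, hprod, Real.sqrt_sq (by positivity), hsq]
    field_simp
  rw [hA, hC, intervalIntegral.integral_const_mul, hsub, hf0, hfπ]

/-- **Freidberg's `q` (6.35) on the printed loop of the Lee–Cerfon equilibrium IS the printed radial integral
(q4):** `safetyFactorE F_B Ψ γ_r (2π) = qLCIntegral q₀ R₀ R_min R_max` with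
`R_min = (R₀² − 2rR₀)^{1/2}`, `R_max = (R₀² + 2rR₀)^{1/2}` (every surface `0 < r < R₀/2`).
[cite: LeeCerfon2015, §4.1 eq. (q4)] -/
theorem safetyFactorE_lcLoop_eq_qLCIntegral {R₀ κ FB q₀ r : ℝ} (hR₀ : 0 < R₀) (hκ : 0 < κ)
    (hFB : 0 < FB) (hq₀ : 0 < q₀) (hr : 0 < r) (h2r : 2 * r < R₀) (a : ℝ) :
    safetyFactorE FB (psiLC κ FB R₀ q₀ a) (lcLoop R₀ κ r) (2 * π)
      = qLCIntegral q₀ R₀ (Real.sqrt (R₀ ^ 2 - 2 * r * R₀)) (Real.sqrt (R₀ ^ 2 + 2 * r * R₀)) := by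
  have h1 : 0 ≤ R₀ ^ 2 - 2 * r * R₀ := by nlinarith
  have h2 : 0 ≤ R₀ ^ 2 + 2 * r * R₀ := by positivity
  rw [safetyFactorE_lcLoop hR₀ hκ hFB hq₀ hr h2r a, integral_lcU_eq_radial hR₀ hr h2r]
  unfold qLCIntegral
  simp only [Real.sq_sqrt h1, Real.sq_sqrt h2]
  ring

/-- **… and hence equals the printed CLOSED FORM (q4)**, `q = (2q₀/π)(R₀³/(R_min² R_max)) E(k)`,
`k = (1 − R_min²/R_max²)^{1/2}`, on every surface (via the discharged `QLCClosedForm`).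
[cite: LeeCerfon2015, §4.1 eq. (q4)] -/
theorem safetyFactorE_lcLoop_eq_qLC {R₀ κ FB q₀ r : ℝ} (hR₀ : 0 < R₀) (hκ : 0 < κ)
    (hFB : 0 < FB) (hq₀ : 0 < q₀) (hr : 0 < r) (h2r : 2 * r < R₀) (a : ℝ) :
    safetyFactorE FB (psiLC κ FB R₀ q₀ a) (lcLoop R₀ κ r) (2 * π)
      = qLC q₀ R₀ (Real.sqrt (R₀ ^ 2 - 2 * r * R₀)) (Real.sqrt (R₀ ^ 2 + 2 * r * R₀)) := by
  have h1 : 0 < R₀ ^ 2 - 2 * r * R₀ := by nlinarith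
  have hlt : Real.sqrt (R₀ ^ 2 - 2 * r * R₀) < Real.sqrt (R₀ ^ 2 + 2 * r * R₀) :=
    Real.sqrt_lt_sqrt h1.le (by nlinarith)
  rw [safetyFactorE_lcLoop_eq_qLCIntegral hR₀ hκ hFB hq₀ hr h2r a,
    qLCIntegral_eq_qLC q₀ R₀ (Real.sqrt_pos.2 h1) hlt]

end Literature.MathematicalPhysics.MHD.Solovev
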